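import Literature.NumberTheory.EllipticCurves.ShimuraSubgroupHeckeCongruence
import Literature.NumberTheory.EllipticCurves.NewformPeterssonSizeSymmSquareProofs
import HarnessLib

/-!
# HYPOTHESIS-FREE NEWFORM LAWS FOR THE SHIMURA INDEX `[Λ₀(f) : Λ₁(f)]` (MEMO-imc §51.10, THEOREM 51.S, `d = 1` shadows; TURNKEY T-imc-51U)

Summit `BirchSwinnertonDyer`, route `ManinLocalTwoThree` (cell bsd-f2-manin), cruxes C2 `ManinOddAtFour` (stmt-BirchSwinnertonDyer-22967) and
C3 `ManinPrimeToThreeAtNine` (stmt-BirchSwinnertonDyer-22968).  Planner seat bsd-f2-manin-imc (LENS imc, planner-of-record), gen 39,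
`Sketch51U.lean` (sha16 e8c40f3b78fb23a3, farm rc 0); landed verbatim by the prover seat p1 (gen 25).

For a `Γ₀(N)`-NEWFORM `f` (tree `IsNewform0`: eigenvalues `a_ℓ = 0` at `ℓ² ∣ N` by `IsNewform0.cuspCoeff_eq_zero_of_sq_dvd`,
`a_p² = 1` at `p ∥ N` by `IsNewform0.cuspCoeff_sq_eq_one_of_dvd_of_not_sq_dvd` — both PROVED) the tree's THEOREM W
(`heckeEigenPeriodCongruence_holds`: `(a_p − p)Λ₀(f) ⊆ Λ₁(f)` at a bad prime) yields, with NO hypothesis beyond newness: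
* U0 `p ∥ N ⇒ ∃ ε = ±1, (ε − p)·Λ₀(f) ⊆ Λ₁(f)` (`exists_sign_sub_mul_mem_periodLatticeGamma1_of_exactlyDvd`);
* U1 `p ∥ N ⇒ (p² − 1)·Λ₀(f) ⊆ Λ₁(f)` (`sq_sub_one_mul_mem_periodLatticeGamma1_of_exactlyDvd`);
* U2 `2 ∥ N ⇒ 3·Λ₀(f) ⊆ Λ₁(f)`;  U3 `3 ∥ N ⇒ 4·Λ₀(f) ⊆ Λ₁(f)`;
* U4 `ℓ² ∣ N, q² ∣ N, ℓ ≠ q ⇒ Λ₁(f) = Λ₀(f)` (`periodLatticeGamma1_eq_of_two_sq_dvd` — e.g. every newform of level `36, 72, 100, 108, 144, 196, 200, 225`);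
* U5 `ℓ² ∣ N, p ∥ N, ℓ ∤ p − 1, ℓ ∤ p + 1 ⇒ Λ₁(f) = Λ₀(f)` (`periodLatticeGamma1_eq_of_sq_dvd_of_exactlyDvd`);
* U6 = U5 for an optimal `X₁(N)`-datum: the Stevens-optimal lattice is the `X₀(N)`-optimal one (`stevensOptimal_isManinOptimal_of_sq_dvd_of_exactlyDvd`).
Census shadow (ref1 §R283, 741 Cremona classes N ≤ 500): `2 ∥ N ⇒ [Λ₀:Λ₁] ∈ {1,3}` 247/247; `3 ∥ N ⇒` a 2-power 227/227; two square primes ⇒ 1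
(64/64); 0 violations.  HONEST FRAMING: fact-free (standard axioms), no definition, no sorry; C2, C3, Manin's conjecture and BSD are NOT
proved by this file.
[cite: Stevens1989, §2, Thm. 1.3] [cite: LingOesterle1991, Thm. 6] [cite: AtkinLehner1970, Thm. 3] [cite: DiamondShurman2005, Prop. 5.8.5]
-/

set_option autoImplicit false
-- the summit-side namespace `Summit.BirchSwinnertonDyer.BirchSwinnertonDyer.…` is the tree's (summit = sub-problem)
set_option linter.dupNamespace false

open scoped MatrixGroups ModularForm
open CongruenceSubgroup

namespace Summit.BirchSwinnertonDyer.BirchSwinnertonDyer.Theorems.ManinLocalTwoThree.ShimuraIndexNewformLaws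

open Literature.NumberTheory.EllipticCurves.ModularForms
open Literature.NumberTheory.EllipticCurves.ModularForms.Gamma1ParametrizationData

variable {N : ℕ} [NeZero N] (f : CuspForm (Gamma0 N) 2)

omit [NeZero N] in
/-- Bézout: `m Λ₀ ⊆ Λ₁`, `n Λ₀ ⊆ Λ₁`, `gcd(m,n) = 1` ⇒ `Λ₁(f) = Λ₀(f)` (as in Sketch51S). [cite: Stevens1989, §2] -/
theorem periodLatticeGamma1_eq_of_two_mul_mem {m n : ℤ}
    (hm : ∀ z ∈ periodLattice f, (m : ℂ) * z ∈ periodLatticeGamma1 f)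
    (hn : ∀ z ∈ periodLattice f, (n : ℂ) * z ∈ periodLatticeGamma1 f)
    (hcop : IsCoprime m n) : periodLatticeGamma1 f = periodLattice f := by
  refine le_antisymm (periodLatticeGamma1_le_periodLattice f) fun z hz ↦ ?_
  obtain ⟨u, v, huv⟩ := hcop
  have hu : (u : ℂ) * ((m : ℂ) * z) ∈ periodLatticeGamma1 f := by
    rw [← zsmul_eq_mul]; exact (periodLatticeGamma1 f).zsmul_mem (hm z hz) u
  have hv : (v : ℂ) * ((n : ℂ) * z) ∈ periodLatticeGamma1 f := by
    rw [← zsmul_eq_mul]; exact (periodLatticeGamma1 f).zsmul_mem (hn z hz) v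
  have e : z = (u : ℂ) * ((m : ℂ) * z) + (v : ℂ) * ((n : ℂ) * z) := by
    have h := congrArg (fun x : ℤ ↦ (x : ℂ)) huv
    push_cast at h ⊢
    linear_combination -z * h
  rw [e]
  exact add_mem hu hv

omit [NeZero N] in
/-- Integer multiples stay in `Λ₁(f)`. [cite: Stevens1989, §2] -/
theorem int_mul_mem_periodLatticeGamma1 {w : ℂ} (hw : w ∈ periodLatticeGamma1 f) (c : ℤ) :
    (c : ℂ) * w ∈ periodLatticeGamma1 f := by
  rw [← zsmul_eq_mul]; exact (periodLatticeGamma1 f).zsmul_mem hw c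

/-- THEOREM W at a bad prime with an INTEGER eigenvalue: `(a − p) Λ₀(f) ⊆ Λ₁(f)`. [cite: Stevens1989, §2] -/
theorem sub_mul_mem_periodLatticeGamma1_of_int_eigen {p : ℕ} [NeZero p] (hp : p.Prime) (hpN : p ∣ N) {a : ℤ}
    (hT : heckeT (Gamma0 N) 2 p f = ((a : ℂ)) • f) :
    ∀ z ∈ periodLattice f, ((a - p : ℤ) : ℂ) * z ∈ periodLatticeGamma1 f := by
  intro z hz
  have h := heckeEigenPeriodCongruence_holds N p f (a : ℂ) hp hpN hT z hz
  push_cast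
  exact h

/-- Newform at `p ∥ N`: `a_p = ε` with `ε = ±1` an integer (from the tree's `a_p² = 1`). [cite: Stevens1989, §2] -/
theorem exists_sign_cuspCoeff_eq_of_exactlyDvd {f : CuspForm (Gamma0 N) 2} (hf : IsNewform0 f) {p : ℕ}
    (hp : p.Prime) (hpN : p ∣ N) (hp2 : ¬ p ^ 2 ∣ N) :
    ∃ ε : ℤ, (ε = 1 ∨ ε = -1) ∧ cuspCoeff f p = (ε : ℂ) := by
  have h1 := hf.cuspCoeff_sq_eq_one_of_dvd_of_not_sq_dvd hp hpN hp2
  have h1' : cuspCoeff f p * cuspCoeff f p = 1 := by rw [← pow_two]; exact h1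
  have h := mul_self_eq_one_iff.1 h1'
  rcases h with h | h
  · exact ⟨1, Or.inl rfl, by rw [h]; norm_num⟩
  · exact ⟨-1, Or.inr rfl, by rw [h]; norm_num⟩

/-- **U0.** `p ∥ N` ⇒ `∃ ε = ±1, (ε − p) Λ₀(f) ⊆ Λ₁(f)` (THEOREM W + `a_p = −w_p = ±1`). [cite: Stevens1989, §2] -/
theorem exists_sign_sub_mul_mem_periodLatticeGamma1_of_exactlyDvd {f : CuspForm (Gamma0 N) 2} (hf : IsNewform0 f)
    {p : ℕ} (hp : p.Prime) (hpN : p ∣ N) (hp2 : ¬ p ^ 2 ∣ N) :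
    ∃ ε : ℤ, (ε = 1 ∨ ε = -1) ∧ ∀ z ∈ periodLattice f, ((ε - p : ℤ) : ℂ) * z ∈ periodLatticeGamma1 f := by
  haveI : NeZero p := ⟨hp.ne_zero⟩
  obtain ⟨ε, hε1, hε⟩ := exists_sign_cuspCoeff_eq_of_exactlyDvd hf hp hpN hp2
  refine ⟨ε, hε1, sub_mul_mem_periodLatticeGamma1_of_int_eigen f hp hpN ?_⟩
  have ep : heckeT (Gamma0 N) 2 p f = cuspCoeff f p • f := hf.heckeT_eq_coeff_smul hp
  rw [ep, hε]

/-- **U1.** `p ∥ N` ⇒ `(p² − 1) Λ₀(f) ⊆ Λ₁(f)`: the Shimura index of a newform quotient is prime to every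
multiplicative prime and divides a power of `∏_{p ∥ N} (p² − 1)` on the multiplicative side (THEOREM 51.S (o)). [cite: Stevens1989, §2] -/
theorem sq_sub_one_mul_mem_periodLatticeGamma1_of_exactlyDvd {f : CuspForm (Gamma0 N) 2} (hf : IsNewform0 f)
    {p : ℕ} (hp : p.Prime) (hpN : p ∣ N) (hp2 : ¬ p ^ 2 ∣ N) :
    ∀ z ∈ periodLattice f, (((p : ℤ) ^ 2 - 1 : ℤ) : ℂ) * z ∈ periodLatticeGamma1 f := by
  obtain ⟨ε, hε1, h⟩ := exists_sign_sub_mul_mem_periodLatticeGamma1_of_exactlyDvd hf hp hpN hp2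
  intro z hz
  have key : ((p : ℤ) ^ 2 - 1) = (-(ε + p)) * (ε - p) := by
    rcases hε1 with rfl | rfl <;> ring
  rw [key, Int.cast_mul, mul_assoc]
  exact int_mul_mem_periodLatticeGamma1 f (h z hz) _

/-- **U2.** `2 ∥ N` ⇒ `3 Λ₀(f) ⊆ Λ₁(f)` — so `s_E ∣ 9`, in particular odd (R283: 247/247 classes, index ∈ {1,3}). [cite: Stevens1989, §2] -/
theorem three_mul_mem_periodLatticeGamma1_of_two_exactlyDvd {f : CuspForm (Gamma0 N) 2} (hf : IsNewform0 f)
    (h2 : 2 ∣ N) (h4 : ¬ 2 ^ 2 ∣ N) : ∀ z ∈ periodLattice f, (3 : ℂ) * z ∈ periodLatticeGamma1 f := by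
  intro z hz
  have h := sq_sub_one_mul_mem_periodLatticeGamma1_of_exactlyDvd hf Nat.prime_two h2 h4 z hz
  norm_num at h
  exact h

/-- **U3.** `3 ∥ N` ⇒ `4 Λ₀(f) ⊆ Λ₁(f)` — so `s_E` is a power of 2 dividing 16 (R283: 227/227 classes). [cite: Stevens1989, §2] -/
theorem four_mul_mem_periodLatticeGamma1_of_three_exactlyDvd {f : CuspForm (Gamma0 N) 2} (hf : IsNewform0 f)
    (h3 : 3 ∣ N) (h9 : ¬ 3 ^ 2 ∣ N) : ∀ z ∈ periodLattice f, (4 : ℂ) * z ∈ periodLatticeGamma1 f := by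
  obtain ⟨ε, hε1, h⟩ := exists_sign_sub_mul_mem_periodLatticeGamma1_of_exactlyDvd hf Nat.prime_three h3 h9
  intro z hz
  have hz1 := h z hz
  rcases hε1 with rfl | rfl
  · -- `(1 − 3) z = −2 z ∈ Λ₁` ⇒ `4 z = (−2)·(−2 z) ∈ Λ₁`
    have h2 := int_mul_mem_periodLatticeGamma1 f hz1 (-2)
    push_cast at h2
    have e : (4 : ℂ) * z = (-2 : ℂ) * (-2 * z) := by ring
    rw [e]; exact h2
  · have h2 := int_mul_mem_periodLatticeGamma1 f hz1 (-1)
    push_cast at h2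
    have e : (4 : ℂ) * z = (-1 : ℂ) * (-4 * z) := by ring
    rw [e]; exact h2

/-- **U4** (newform dress of E-imc-21). Two distinct primes with square dividing `N` ⇒ `Λ₁(f) = Λ₀(f)` (`s_A = 1`). [cite: Stevens1989, §2] -/
theorem periodLatticeGamma1_eq_of_two_sq_dvd {f : CuspForm (Gamma0 N) 2} (hf : IsNewform0 f) {ℓ q : ℕ}
    (hℓ : ℓ.Prime) (hq : q.Prime) (hne : ℓ ≠ q) (hℓN : ℓ ^ 2 ∣ N) (hqN : q ^ 2 ∣ N) :
    periodLatticeGamma1 f = periodLattice f := by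
  haveI : NeZero ℓ := ⟨hℓ.ne_zero⟩
  haveI : NeZero q := ⟨hq.ne_zero⟩
  have hℓN' : ℓ ∣ N := (dvd_pow_self ℓ two_ne_zero).trans hℓN
  have hqN' : q ∣ N := (dvd_pow_self q two_ne_zero).trans hqN
  have eℓ : heckeT (Gamma0 N) 2 ℓ f = cuspCoeff f ℓ • f := hf.heckeT_eq_coeff_smul hℓ
  have eq' : heckeT (Gamma0 N) 2 q f = cuspCoeff f q • f := hf.heckeT_eq_coeff_smul hq
  have hTℓ : heckeT (Gamma0 N) 2 ℓ f = (((0 : ℤ) : ℂ)) • f := by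
    rw [eℓ, hf.cuspCoeff_eq_zero_of_sq_dvd hℓ hℓN, Int.cast_zero]
  have hTq : heckeT (Gamma0 N) 2 q f = (((0 : ℤ) : ℂ)) • f := by
    rw [eq', hf.cuspCoeff_eq_zero_of_sq_dvd hq hqN, Int.cast_zero]
  refine periodLatticeGamma1_eq_of_two_mul_mem f (sub_mul_mem_periodLatticeGamma1_of_int_eigen f hℓ hℓN' hTℓ)
    (sub_mul_mem_periodLatticeGamma1_of_int_eigen f hq hqN' hTq) ?_
  have e1 : (0 - (ℓ : ℤ)) = -(ℓ : ℤ) := by ring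
  have e2 : (0 - (q : ℤ)) = -(q : ℤ) := by ring
  rw [e1, e2]
  refine (IsCoprime.neg_left ?_).neg_right
  rw [Nat.isCoprime_iff_coprime]
  exact (Nat.coprime_primes hℓ hq).mpr hne

/-- **U5 = T-imc-51U (hypothesis-free T-imc-51S′; NEW range).** `ℓ² ∣ N`, `p ∥ N`, `ℓ ∤ p − 1`, `ℓ ∤ p + 1`
⇒ `Λ₁(f) = Λ₀(f)`: e.g. every newform of level `ℓ² M` with `ℓ ≥ 5` and `2 ∥ M` or `3 ∥ M`. [cite: Stevens1989, §2] -/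
theorem periodLatticeGamma1_eq_of_sq_dvd_of_exactlyDvd {f : CuspForm (Gamma0 N) 2} (hf : IsNewform0 f) {ℓ p : ℕ}
    (hℓ : ℓ.Prime) (hp : p.Prime) (hℓN : ℓ ^ 2 ∣ N) (hpN : p ∣ N) (hp2 : ¬ p ^ 2 ∣ N)
    (h1 : ¬ (ℓ : ℤ) ∣ (p : ℤ) - 1) (h1' : ¬ (ℓ : ℤ) ∣ (p : ℤ) + 1) :
    periodLatticeGamma1 f = periodLattice f := by
  haveI : NeZero ℓ := ⟨hℓ.ne_zero⟩
  haveI : NeZero p := ⟨hp.ne_zero⟩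
  have hℓN' : ℓ ∣ N := (dvd_pow_self ℓ two_ne_zero).trans hℓN
  have eℓ : heckeT (Gamma0 N) 2 ℓ f = cuspCoeff f ℓ • f := hf.heckeT_eq_coeff_smul hℓ
  have ep : heckeT (Gamma0 N) 2 p f = cuspCoeff f p • f := hf.heckeT_eq_coeff_smul hp
  have hTℓ : heckeT (Gamma0 N) 2 ℓ f = (((0 : ℤ) : ℂ)) • f := by
    rw [eℓ, hf.cuspCoeff_eq_zero_of_sq_dvd hℓ hℓN, Int.cast_zero]
  obtain ⟨ε, hε1, hε⟩ := exists_sign_cuspCoeff_eq_of_exactlyDvd hf hp hpN hp2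
  have hTp : heckeT (Gamma0 N) 2 p f = ((ε : ℂ)) • f := by rw [ep, hε]
  refine periodLatticeGamma1_eq_of_two_mul_mem f (sub_mul_mem_periodLatticeGamma1_of_int_eigen f hℓ hℓN' hTℓ)
    (sub_mul_mem_periodLatticeGamma1_of_int_eigen f hp hpN hTp) ?_
  have e1 : (0 - (ℓ : ℤ)) = -(ℓ : ℤ) := by ring
  rw [e1]
  refine IsCoprime.neg_left ((Nat.prime_iff_prime_int.mp hℓ).coprime_iff_not_dvd.mpr ?_)
  rcases hε1 with rfl | rfl
  · intro h; exact h1 (by have := h.neg_right; simpa using this)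
  · intro h; exact h1' (by have := h.neg_right; simpa [add_comm] using this)

/-- **U6 (COR; hypothesis-free Stevens-optimal = Manin-optimal on the U5 range).** [cite: Stevens1989, §2] -/
theorem stevensOptimal_isManinOptimal_of_sq_dvd_of_exactlyDvd (W : WeierstrassCurve ℚ)
    (D : Gamma1ParametrizationData W N) (hf : IsNewform0 D.f) {ℓ p : ℕ} (hℓ : ℓ.Prime) (hp : p.Prime)
    (hℓN : ℓ ^ 2 ∣ N) (hpN : p ∣ N) (hp2 : ¬ p ^ 2 ∣ N) (h1 : ¬ (ℓ : ℤ) ∣ (p : ℤ) - 1)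
    (h1' : ¬ (ℓ : ℤ) ∣ (p : ℤ) + 1) (hopt : D.IsOptimal) :
    ∀ z : ℂ, z ∈ D.L.lattice ↔ ∃ w ∈ periodLattice D.f, z = D.c * w := by
  intro z
  rw [← periodLatticeGamma1_eq_of_sq_dvd_of_exactlyDvd hf hℓ hp hℓN hpN hp2 h1 h1']
  exact hopt.mem_lattice_iff z

/-- Side conditions of U5 at the first levels of the new range (`ℓ ∤ p ∓ 1`), by `decide`. [cite: Stevens1989, §2] -/
theorem U5_side_conditions :
    (¬ (5 : ℤ) ∣ 2 - 1 ∧ ¬ (5 : ℤ) ∣ 2 + 1) ∧ (¬ (5 : ℤ) ∣ 3 - 1 ∧ ¬ (5 : ℤ) ∣ 3 + 1) ∧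
    (¬ (7 : ℤ) ∣ 2 - 1 ∧ ¬ (7 : ℤ) ∣ 2 + 1) ∧ (¬ (7 : ℤ) ∣ 3 - 1 ∧ ¬ (7 : ℤ) ∣ 3 + 1) ∧
    (¬ (7 : ℤ) ∣ 5 - 1 ∧ ¬ (7 : ℤ) ∣ 5 + 1) ∧ (¬ (11 : ℤ) ∣ 2 - 1 ∧ ¬ (11 : ℤ) ∣ 2 + 1) ∧
    (¬ (5 : ℤ) ∣ 7 - 1 ∧ ¬ (5 : ℤ) ∣ 7 + 1) ∧ (¬ (5 : ℤ) ∣ 13 - 1 ∧ ¬ (5 : ℤ) ∣ 13 + 1) := by decide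

end Summit.BirchSwinnertonDyer.BirchSwinnertonDyer.Theorems.ManinLocalTwoThree.ShimuraIndexNewformLaws
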